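import Summits.HodgeConjecture.CorCM.MultiFieldWeilSimpleSlots
import Summits.HodgeConjecture.CorCM.MultiFieldWeilNonIsomorphicGroupBlocks
import Summits.HodgeConjecture.CorCM.MultiFieldWeilForeignBlocks
import Summits.HodgeConjecture.CorCM.MultiFieldWeilQuadraticSexticClosures
import HarnessLib

/-!
# MULTI-FIELD WEIL ENGINE — THE MENU AS A BLOCK OF A UNIFORM FAMILY, AND SEVERAL IMAGINARY QUADRATIC FIELDS AT ONCE: for each `k_c` its CM curves, SIMPLE CM
# threefolds, SIMPLE CM fourfolds (`𝔄₄`/`𝔖₄` quartic part) and `(2,3)`-fivefolds through `k_c`; blocks pairwise FOREIGN ⟹ the Hodge conjecture for every product of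
# copies, given only Markman's fourfold and hyperbolic-sixfold theorems

Cell `pub-hodgecm2` (COR-CM), seat b30 gen 38 (2026-08-25); count-neutral own lane MULTI-FIELD WEIL ENGINE (stem `MultiFieldWeil*`), the family dress of
`CorCM/MultiFieldWeilSimpleSlots.lean` §3 (`hodgeConjectureFor_biproduct_comp_menu_of_isSimple`, the quotable menu over ONE `k`) after the pattern of gen 35's
`CorCM/MultiFieldWeilNonIsomorphicGroupBlocks.lean` (the sextic group block), glued over several `k` by gen 31's UNCONDITIONAL `CorCM/MultiFieldWeilForeignBlocks.lean`
(`hodgeConjectureFor_prod_of_foreign_blocks_of_conj_apply_eq`).  Theorems only; no definition, no named fact, no `sorry`.  HONEST FRAMING: conditional ONLY on the two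
displayed Markman binders; `HC_CM` is NOT proved and not asserted.

§1 **THE MENU BLOCK** (`hodgeConjectureFor_prod_menuBlock`).  A uniform family `A_i ⊨ (K_i; Φ_i)` (`i ∈ I`); an imaginary quadratic field `k` with `τ : k → ℂ`; slots
`e : Fin r → I` with `i_m : k ↪ K_{e m}`, `[K_{e m} : k] = n_m ∈ {3, 4, 5}` and the menu hypotheses of the quotable form (SIMPLE for `n_m ∈ {3,4}`; `2` or `3` type members over
`τ` for `n_m = 5`; degree `24` for octic fields; `Hom = ∅` for sextic and for decic pairs; a value outside the closure for octic → octic ∕ sextic pairs); a product of copies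
`⨁_l A_{ρ l}` every member of which is a slot `e m` or a CM elliptic CURVE whose (quadratic) field maps to `k`.  Then the Hodge conjecture holds for it (the product is
isogenous to a product of copies of the engine family `Fin.cons E_k (A ∘ e)`; all such curves are isogenous to `E_k`).
§2 **SEVERAL IMAGINARY QUADRATIC FIELDS** (`hodgeConjectureFor_prod_of_menuBlocks`, `…_of_inf_eq_bot`): labels `b : I → C`, for each label `c` a field `k_c` and a menu block
as in §1 covering the members of label `c`; for each `c`, complex conjugation fixes the intersection of the compositum of the Galois closures of the fields of label `c` with
that of all other labels (e.g. the two composita meet in `ℚ`).  Then the Hodge conjecture holds for EVERY product of copies `⨁_j A_{π j}` of the whole family and everything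
it dominates.  (Example: `E_{k₁} × T₁ × B₁ × F₁ × E_{k₂} × T₂ × …` with the menu over `k₁` and over `k₂` and linearly disjoint closure composita.)

[cite: Markman2025SurveySecant, Thm. 1.2] [cite: Markman2025SecantWeil, Thm 1.5.1] [cite: Pohlmann1968, Thm 1] [cite: Milne2020HodgeClassesAV, 1.2 (a) and Thm. 1]
[cite: Shimura1998, §6.1 Corollary of Theorem 2, §8.2 Prop. 26, §18.2 Lemma (i)] [cite: Deligne1982HodgeCycles, §5 (b)] [cite: Lang2002, VI §1 Thm. 1.14 and V §2 Thm. 2.8]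
[cite: DixonMortimer1996, §3.3, Thm. 3.3A] [cite: Dodson1984, §1.1 Imprimitivity Theorem] [cite: MumfordAV1970, §19]

## References
* [Markman2025SurveySecant] E. Markman, arXiv:2509.23403, Thm. 1.2.  [Markman2025SecantWeil] E. Markman, Cycles on abelian 2n-folds of Weil type from secant sheaves on abelian
  n-folds, Thm 1.5.1.  [Pohlmann1968] H. Pohlmann, Ann. of Math. 88 (1968), Thm 1.  [Milne2020HodgeClassesAV] J. S. Milne, Hodge classes on abelian varieties (2020), §1.
  [Shimura1998] G. Shimura, *Abelian varieties with complex multiplication and modular functions*, §6.1, §8.2, §18.2.  [Deligne1982HodgeCycles] P. Deligne, LNM 900, §5 (b).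
  [Lang2002] S. Lang, *Algebra*, GTM 211, V §2, VI §1.  [DixonMortimer1996] J. D. Dixon, B. Mortimer, *Permutation Groups*, GTM 163, §3.3.  [Dodson1984] B. Dodson, Trans.
  AMS 283 (1984), §1.1.  [MumfordAV1970] D. Mumford, *Abelian Varieties*, §19.
-/

noncomputable section

open CategoryTheory CategoryTheory.Limits NumberField IntermediateField

namespace Summit.HodgeConjecture.CorCM.MultiFieldWeil

open Finset
open Literature.AlgebraicGeometry Literature.AlgebraicGeometry.Motives Literature.AlgebraicGeometry.HodgeTheory
open Literature.AlgebraicGeometry.ComplexMultiplication (IsCMTypeRealisation)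
open Literature.AlgebraicTopology.SingularHomology
open Literature.NumberTheory.ComplexMultiplication

open scoped Classical

/-! ## §0 `Fin.cons` with a transported predicate -/

section Cons

variable {I : Type} {r : ℕ} {Kf : I → Type} [∀ i, Field (Kf i)] [∀ i, NumberField (Kf i)] {i₀ : I} {is : Fin r → I}
  {T : Fin r → AbelianVariety ℂ} {ΦT : ∀ m : Fin r, CMType (Kf (is m))}
  {ιT : ∀ m, 𝓞 (Kf (is m)) →+* End (T m)} {θT : ∀ m, Kf (is m) →+* Module.End ℂ (complexBetti (T m).X 1)}

/-- **`Fin.cons E T` with its realisation data and a slotwise predicate** (gen 33's `exists_realisations_cons`, returning `Q m (Φ (m+1))` from `Q m (ΦT m)` instead of an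
equation of types). [folklore] -/
theorem exists_realisations_cons_of {Ψ : CMType (Kf i₀)} {E : AbelianVariety ℂ} {ιE : 𝓞 (Kf i₀) →+* End E} {θE : Kf i₀ →+* Module.End ℂ (complexBetti E.X 1)}
    (hE : IsCMTypeRealisation Ψ E ιE θE) (hT : ∀ m, IsCMTypeRealisation (ΦT m) (T m) (ιT m) (θT m)) (Q : ∀ m : Fin r, CMType (Kf (is m)) → Prop)
    (hQ : ∀ m, Q m (ΦT m)) :
    ∃ (Φ : ∀ j : Fin (r + 1), CMType (Kf (mfSlots i₀ is j)))
      (ι : ∀ j, 𝓞 (Kf (mfSlots i₀ is j)) →+* End ((Fin.cons E T : Fin (r + 1) → AbelianVariety ℂ) j))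
      (θ : ∀ j, Kf (mfSlots i₀ is j) →+* Module.End ℂ (complexBetti ((Fin.cons E T : Fin (r + 1) → AbelianVariety ℂ) j).X 1)),
      (∀ j, IsCMTypeRealisation (Φ j) ((Fin.cons E T : Fin (r + 1) → AbelianVariety ℂ) j) (ι j) (θ j)) ∧ Φ 0 = Ψ ∧ ∀ m : Fin r, Q m (Φ m.succ) := by
  refine ⟨Fin.cons Ψ ΦT, Fin.cons ιE ιT, Fin.cons θE θT, Fin.cases hE (fun m => ?_), rfl, fun m => hQ m⟩
  exact hT m

end Cons

/-! ## §1 The menu block of a uniform family -/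

section Block

variable {I : Type} {K : I → Type} [fK : ∀ i, Field (K i)] [nK : ∀ i, NumberField (K i)] [cK : ∀ i, IsCMField (K i)]
  {Φ : ∀ i, CMType (K i)} {A : I → AbelianVariety ℂ} {ι : ∀ i, 𝓞 (K i) →+* End (A i)} {θ : ∀ i, K i →+* Module.End ℂ (complexBetti (A i).X 1)}

/-- **THE MENU BLOCK.**  `A_i ⊨ (K_i; Φ_i)` a uniform family; `k` imaginary quadratic with `τ : k → ℂ`; slots `e : Fin r → I` with `i_m : k ↪ K_{e m}`, `[K_{e m} : k] = n_m ∈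
{3, 4, 5}`: `A_{e m}` SIMPLE for `n_m ∈ {3, 4}`; `2` or `3` members of `Φ_{e m}` over `τ` for `n_m = 5`; for `n_m = 4` two `τ`-embeddings generating degree `24` with `τ(k)`;
`Hom(K_{e m}, K_{e m₀}) = ∅` for `m₀ ≠ m` both sextic or both decic; for `K_{e m₀}` octic and `K_{e m}` octic or sextic a `τ`-embedding of `K_{e m}` with a value outside
`L(K_{e m₀})`; and a product of copies `⨁_l A_{ρ l}` each member of which is some `A_{e m}` or a CM elliptic curve whose field maps to `k`.  Then the Hodge conjecture holds for
it, GIVEN ONLY Markman's two theorems (every such curve is isogenous to the CM curve `E ⊨ (k; {τ})`; the product is isogenous to a product of copies of `Fin.cons E (A ∘ e)`;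
`hodgeConjectureFor_biproduct_comp_menu_of_isSimple`).  `HC_CM` is NOT asserted. [cite: Markman2025SurveySecant, Thm. 1.2] [cite: Markman2025SecantWeil, Thm 1.5.1]
[cite: Shimura1998, §6.1 Corollary of Theorem 2, §8.2 Prop. 26, §18.2 Lemma (i)] [cite: Deligne1982HodgeCycles, §5 (b)] [cite: DixonMortimer1996, §3.3, Thm. 3.3A] -/
theorem hodgeConjectureFor_prod_menuBlock (hW4 : Markman2025_weilClasses_algebraic_abelianFourfold) (hM6 : Markman2025_weilClasses_algebraic_hyperbolicSixfold)
    (hA : ∀ i, IsCMTypeRealisation (Φ i) (A i) (ι i) (θ i)) {r : ℕ} (e : Fin r → I) (n : Fin r → ℕ) (hn : ∀ m, n m = 3 ∨ n m = 4 ∨ n m = 5)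
    (hdeg : ∀ m, Module.finrank ℚ (K (e m)) = 2 * n m)
    {k : Type} [fk : Field k] [nk : NumberField k] [ck : IsCMField k] (h2 : Module.finrank ℚ k = 2) (i : ∀ m, k →+* K (e m)) (τ : k →+* ℂ)
    (hS : ∀ m, n m = 3 ∨ n m = 4 → (A (e m)).IsSimple)
    (h23 : ∀ m, n m = 5 → (Finset.univ.filter fun s : K (e m) →+* ℂ => s.comp (i m) = τ ∧ s ∈ (Φ (e m)).1).card = 2 ∨
      (Finset.univ.filter fun s : K (e m) →+* ℂ => s.comp (i m) = τ ∧ s ∈ (Φ (e m)).1).card = 3)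
    (h24 : ∀ m, n m = 4 → ∃ s₀ t₀ : K (e m) →+* ℂ, s₀.comp (i m) = τ ∧ t₀.comp (i m) = τ ∧ s₀ ≠ t₀ ∧
      Module.finrank ℚ ↥(adjoin ℚ (Set.range τ) ⊔ adjoin ℚ (Set.range s₀ ∪ Set.range t₀)) = 24)
    (hiso : ∀ m₀ m, m₀ ≠ m → n m₀ = n m → (n m = 3 ∨ n m = 5) → IsEmpty (K (e m) →+* K (e m₀)))
    (hout4 : ∀ m₀ m, m₀ ≠ m → n m₀ = 4 → (n m = 4 ∨ n m = 3) → ∃ s : K (e m) →+* ℂ, s.comp (i m) = τ ∧ ∃ x, s x ∉ normalClosure ℚ (K (e m₀)) ℂ)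
    {M : ℕ} (ρ : Fin M → I) (hρ : ∀ l, (Module.finrank ℚ (K (ρ l)) = 2 ∧ Nonempty (K (ρ l) →+* k)) ∨ ∃ m, ρ l = e m) :
    HodgeConjectureFor (⨁ fun l => A (ρ l)).dim (⨁ fun l => A (ρ l)).X := by
  -- the CM elliptic curve of `k`
  obtain ⟨Ψ, E, ιE, θE, hE, hΨ⟩ := exists_cmCurve_iff_eq h2 τ
  -- every curve member is isogenous to `E`
  have hcurve : ∀ l, (Module.finrank ℚ (K (ρ l)) = 2 ∧ Nonempty (K (ρ l) →+* k)) → AbelianVariety.IsIsogenous (A (ρ l)) E := by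
    rintro l ⟨h2l, ⟨g⟩⟩
    obtain ⟨φ⟩ := nonempty_ringEquiv_of_ringHom_of_finrank_eq g (h2l.trans h2.symm)
    exact isIsogenous_of_ringEquiv h2l (hA (ρ l)) hE φ.symm
  -- the engine family `Fin.cons E (A ∘ e)` over the fields `Option.elim · k K`
  let Kf : Option I → Type := fun o => o.elim k K
  letI instF : ∀ o, Field (Kf o) := fun o => @Option.rec I (fun o => Field (Option.elim o k K)) fk (fun j => fK j) o
  letI instN : ∀ o, NumberField (Kf o) := fun o => @Option.rec I (fun o => NumberField (Option.elim o k K)) nk (fun j => nK j) o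
  haveI instC : ∀ o, IsCMField (Kf o) := fun o => @Option.rec I (fun o => IsCMField (Option.elim o k K)) ck (fun j => cK j) o
  obtain ⟨Φ', ι', θ', hA', h0, h23'⟩ := exists_realisations_cons_of (Kf := Kf) (i₀ := none) (is := fun m => some (e m)) (T := fun m => A (e m))
    (ΦT := fun m => Φ (e m)) (ιT := fun m => ι (e m)) (θT := fun m => θ (e m)) (Ψ := Ψ) (E := E) (ιE := ιE) (θE := θE) hE (fun m => hA (e m))
    (fun m Φ'' => n m = 5 → (Finset.univ.filter fun s : K (e m) →+* ℂ => s.comp (i m) = τ ∧ s ∈ Φ''.1).card = 2 ∨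
      (Finset.univ.filter fun s : K (e m) →+* ℂ => s.comp (i m) = τ ∧ s ∈ Φ''.1).card = 3) h23
  have hΨ' : ∀ σ : Kf none →+* ℂ, σ ∈ (Φ' 0).1 ↔ σ = τ := by rw [h0]; exact hΨ
  -- the slot map
  let σ : I → Fin (r + 1) := fun x => if h : ∃ m, x = e m then (Classical.choose h).succ else 0
  have hσ : ∀ l, AbelianVariety.IsIsogenous (A (ρ l)) ((Fin.cons E (fun m => A (e m)) : Fin (r + 1) → AbelianVariety ℂ) (σ (ρ l))) := by
    intro l
    by_cases h : ∃ m, ρ l = e m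
    · have hs : σ (ρ l) = (Classical.choose h).succ := by simp only [σ, dif_pos h]
      rw [hs, Fin.cons_succ, ← Classical.choose_spec h]
      exact AbelianVariety.IsIsogenous.refl _
    · have hs : σ (ρ l) = 0 := by simp only [σ, dif_neg h]
      rw [hs, Fin.cons_zero]
      exact hcurve l ((hρ l).resolve_right h)
  have hiso' : AbelianVariety.IsIsogenous (⨁ fun l => A (ρ l)) (⨁ fun l => (Fin.cons E (fun m => A (e m)) : Fin (r + 1) → AbelianVariety ℂ) (σ (ρ l))) :=
    AbelianVariety.IsIsogenous.biproduct hσ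
  refine Domination.hodgeConjectureFor_of_avDominatedBy ?_ (Domination.AVDominatedBy.of_isIsogenous hiso' (Domination.AVDominatedBy.refl _))
  exact hodgeConjectureFor_biproduct_comp_menu_of_isSimple (Kf := Kf) (i₀ := none) (is := fun m => some (e m)) hW4 hM6 n hn (fun l => σ (ρ l)) h2 hdeg i hA' hΨ'
    (fun m h => by rw [Fin.cons_succ]; exact hS m h) h23' h24 hiso hout4

/-- **Dominated form of the menu block.** [cite: Markman2025SurveySecant, Thm. 1.2] [cite: Markman2025SecantWeil, Thm 1.5.1] [cite: MumfordAV1970, §19] -/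
theorem hodgeConjectureFor_of_avDominatedBy_prod_menuBlock (hW4 : Markman2025_weilClasses_algebraic_abelianFourfold)
    (hM6 : Markman2025_weilClasses_algebraic_hyperbolicSixfold) (hA : ∀ i, IsCMTypeRealisation (Φ i) (A i) (ι i) (θ i)) {r : ℕ} (e : Fin r → I) (n : Fin r → ℕ)
    (hn : ∀ m, n m = 3 ∨ n m = 4 ∨ n m = 5) (hdeg : ∀ m, Module.finrank ℚ (K (e m)) = 2 * n m)
    {k : Type} [Field k] [NumberField k] [IsCMField k] (h2 : Module.finrank ℚ k = 2) (i : ∀ m, k →+* K (e m)) (τ : k →+* ℂ)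
    (hS : ∀ m, n m = 3 ∨ n m = 4 → (A (e m)).IsSimple)
    (h23 : ∀ m, n m = 5 → (Finset.univ.filter fun s : K (e m) →+* ℂ => s.comp (i m) = τ ∧ s ∈ (Φ (e m)).1).card = 2 ∨
      (Finset.univ.filter fun s : K (e m) →+* ℂ => s.comp (i m) = τ ∧ s ∈ (Φ (e m)).1).card = 3)
    (h24 : ∀ m, n m = 4 → ∃ s₀ t₀ : K (e m) →+* ℂ, s₀.comp (i m) = τ ∧ t₀.comp (i m) = τ ∧ s₀ ≠ t₀ ∧
      Module.finrank ℚ ↥(adjoin ℚ (Set.range τ) ⊔ adjoin ℚ (Set.range s₀ ∪ Set.range t₀)) = 24)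
    (hiso : ∀ m₀ m, m₀ ≠ m → n m₀ = n m → (n m = 3 ∨ n m = 5) → IsEmpty (K (e m) →+* K (e m₀)))
    (hout4 : ∀ m₀ m, m₀ ≠ m → n m₀ = 4 → (n m = 4 ∨ n m = 3) → ∃ s : K (e m) →+* ℂ, s.comp (i m) = τ ∧ ∃ x, s x ∉ normalClosure ℚ (K (e m₀)) ℂ)
    {M : ℕ} (ρ : Fin M → I) (hρ : ∀ l, (Module.finrank ℚ (K (ρ l)) = 2 ∧ Nonempty (K (ρ l) →+* k)) ∨ ∃ m, ρ l = e m)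
    {X : AbelianVariety ℂ} (hX : Domination.AVDominatedBy X (⨁ fun l => A (ρ l))) : HodgeConjectureFor X.dim X.X :=
  Domination.hodgeConjectureFor_of_avDominatedBy (hodgeConjectureFor_prod_menuBlock hW4 hM6 hA e n hn hdeg h2 i τ hS h23 h24 hiso hout4 ρ hρ) hX

end Block

/-! ## §2 Several imaginary quadratic fields: foreign menu blocks glue -/

section Several

variable {I : Type} [Finite I] [Nonempty I] {K : I → Type} [∀ i, Field (K i)] [∀ i, NumberField (K i)] [∀ i, IsCMField (K i)]
  {Φ : ∀ i, CMType (K i)} {A : I → AbelianVariety ℂ} {ι : ∀ i, 𝓞 (K i) →+* End (A i)} {θ : ∀ i, K i →+* Module.End ℂ (complexBetti (A i).X 1)}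
  {C : Type} {r : C → ℕ} {kc : C → Type} [∀ c, Field (kc c)] [∀ c, NumberField (kc c)] [∀ c, IsCMField (kc c)]

/-- **SEVERAL IMAGINARY QUADRATIC FIELDS — FOREIGN MENU BLOCKS GLUE, GIVEN ONLY MARKMAN'S TWO THEOREMS.**  `A_i ⊨ (K_i; Φ_i)` (`i ∈ I` finite, non-empty); labels `b : I → C`;
for each label `c`: an imaginary quadratic field `k_c` with `τ_c`, slots `e_c : Fin r_c → I` satisfying the hypotheses of the menu block over `k_c`
(`hodgeConjectureFor_prod_menuBlock`), such that every member of label `c` is a slot `e_c m` or a CM elliptic curve whose field maps to `k_c`; and for each `c` complex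
conjugation fixes the intersection of the compositum of the Galois closures of the fields of label `c` with that of the other labels (pairwise FOREIGN blocks; gen 31's
gluing `hodgeConjectureFor_prod_of_foreign_blocks_of_conj_apply_eq`, unconditional).  Then the Hodge conjecture holds for EVERY product of copies `⨁_j A_{π j}`.  `HC_CM`
is NOT asserted. [cite: Markman2025SurveySecant, Thm. 1.2] [cite: Markman2025SecantWeil, Thm 1.5.1] [cite: Pohlmann1968, Thm 1] [cite: Milne2020HodgeClassesAV, 1.2 (a) and Thm. 1]
[cite: Lang2002, VI §1 Thm. 1.14 and V §2 Thm. 2.8] -/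
theorem hodgeConjectureFor_prod_of_menuBlocks (hW4 : Markman2025_weilClasses_algebraic_abelianFourfold) (hM6 : Markman2025_weilClasses_algebraic_hyperbolicSixfold)
    (hA : ∀ i, IsCMTypeRealisation (Φ i) (A i) (ι i) (θ i)) (b : I → C) (e : ∀ c, Fin (r c) → I) (n : ∀ c, Fin (r c) → ℕ)
    (hn : ∀ c m, n c m = 3 ∨ n c m = 4 ∨ n c m = 5) (hdeg : ∀ c m, Module.finrank ℚ (K (e c m)) = 2 * n c m)
    (h2c : ∀ c, Module.finrank ℚ (kc c) = 2) (i : ∀ c m, kc c →+* K (e c m)) (τ : ∀ c, kc c →+* ℂ)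
    (hS : ∀ c m, n c m = 3 ∨ n c m = 4 → (A (e c m)).IsSimple)
    (h23 : ∀ c m, n c m = 5 → (Finset.univ.filter fun s : K (e c m) →+* ℂ => s.comp (i c m) = τ c ∧ s ∈ (Φ (e c m)).1).card = 2 ∨
      (Finset.univ.filter fun s : K (e c m) →+* ℂ => s.comp (i c m) = τ c ∧ s ∈ (Φ (e c m)).1).card = 3)
    (h24 : ∀ c m, n c m = 4 → ∃ s₀ t₀ : K (e c m) →+* ℂ, s₀.comp (i c m) = τ c ∧ t₀.comp (i c m) = τ c ∧ s₀ ≠ t₀ ∧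
      Module.finrank ℚ ↥(adjoin ℚ (Set.range (τ c)) ⊔ adjoin ℚ (Set.range s₀ ∪ Set.range t₀)) = 24)
    (hiso : ∀ c m₀ m, m₀ ≠ m → n c m₀ = n c m → (n c m = 3 ∨ n c m = 5) → IsEmpty (K (e c m) →+* K (e c m₀)))
    (hout4 : ∀ c m₀ m, m₀ ≠ m → n c m₀ = 4 → (n c m = 4 ∨ n c m = 3) →
      ∃ s : K (e c m) →+* ℂ, s.comp (i c m) = τ c ∧ ∃ x, s x ∉ normalClosure ℚ (K (e c m₀)) ℂ)
    (hcov : ∀ x : I, (Module.finrank ℚ (K x) = 2 ∧ Nonempty (K x →+* kc (b x))) ∨ ∃ m, x = e (b x) m)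
    (hreal : ∀ (c : C) (z : ℂ), z ∈ (⨆ x : {x : I // b x = c}, normalClosure ℚ (K x.1) ℂ) → z ∈ (⨆ x : {x : I // b x ≠ c}, normalClosure ℚ (K x.1) ℂ) →
      starRingEnd ℂ z = z)
    {N : ℕ} (π : Fin N → I) : HodgeConjectureFor (⨁ fun j => A (π j)).dim (⨁ fun j => A (π j)).X := by
  refine hodgeConjectureFor_prod_of_foreign_blocks_of_conj_apply_eq hA b hreal (fun c M ρ hρc => ?_) π
  refine hodgeConjectureFor_prod_menuBlock hW4 hM6 hA (e c) (n c) (hn c) (hdeg c) (h2c c) (i c) (τ c) (hS c) (h23 c) (h24 c) (hiso c) (hout4 c) ρ fun l => ?_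
  have h := hcov (ρ l)
  rw [hρc l] at h
  exact h

/-- **Blocks whose closure composita meet in `ℚ`** (the simplest foreignness test). [cite: Lang2002, VI §1 Thm. 1.14] [cite: Markman2025SurveySecant, Thm. 1.2] [cite: Markman2025SecantWeil, Thm 1.5.1] -/
theorem hodgeConjectureFor_prod_of_menuBlocks_of_inf_eq_bot (hW4 : Markman2025_weilClasses_algebraic_abelianFourfold)
    (hM6 : Markman2025_weilClasses_algebraic_hyperbolicSixfold) (hA : ∀ i, IsCMTypeRealisation (Φ i) (A i) (ι i) (θ i)) (b : I → C) (e : ∀ c, Fin (r c) → I)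
    (n : ∀ c, Fin (r c) → ℕ) (hn : ∀ c m, n c m = 3 ∨ n c m = 4 ∨ n c m = 5) (hdeg : ∀ c m, Module.finrank ℚ (K (e c m)) = 2 * n c m)
    (h2c : ∀ c, Module.finrank ℚ (kc c) = 2) (i : ∀ c m, kc c →+* K (e c m)) (τ : ∀ c, kc c →+* ℂ)
    (hS : ∀ c m, n c m = 3 ∨ n c m = 4 → (A (e c m)).IsSimple)
    (h23 : ∀ c m, n c m = 5 → (Finset.univ.filter fun s : K (e c m) →+* ℂ => s.comp (i c m) = τ c ∧ s ∈ (Φ (e c m)).1).card = 2 ∨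
      (Finset.univ.filter fun s : K (e c m) →+* ℂ => s.comp (i c m) = τ c ∧ s ∈ (Φ (e c m)).1).card = 3)
    (h24 : ∀ c m, n c m = 4 → ∃ s₀ t₀ : K (e c m) →+* ℂ, s₀.comp (i c m) = τ c ∧ t₀.comp (i c m) = τ c ∧ s₀ ≠ t₀ ∧
      Module.finrank ℚ ↥(adjoin ℚ (Set.range (τ c)) ⊔ adjoin ℚ (Set.range s₀ ∪ Set.range t₀)) = 24)
    (hiso : ∀ c m₀ m, m₀ ≠ m → n c m₀ = n c m → (n c m = 3 ∨ n c m = 5) → IsEmpty (K (e c m) →+* K (e c m₀)))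
    (hout4 : ∀ c m₀ m, m₀ ≠ m → n c m₀ = 4 → (n c m = 4 ∨ n c m = 3) →
      ∃ s : K (e c m) →+* ℂ, s.comp (i c m) = τ c ∧ ∃ x, s x ∉ normalClosure ℚ (K (e c m₀)) ℂ)
    (hcov : ∀ x : I, (Module.finrank ℚ (K x) = 2 ∧ Nonempty (K x →+* kc (b x))) ∨ ∃ m, x = e (b x) m)
    (hinf : ∀ c : C, (⨆ x : {x : I // b x = c}, normalClosure ℚ (K x.1) ℂ) ⊓ (⨆ x : {x : I // b x ≠ c}, normalClosure ℚ (K x.1) ℂ) = ⊥)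
    {N : ℕ} (π : Fin N → I) : HodgeConjectureFor (⨁ fun j => A (π j)).dim (⨁ fun j => A (π j)).X := by
  refine hodgeConjectureFor_prod_of_foreign_blocks_of_inf_eq_bot hA b hinf (fun c M ρ hρc => ?_) π
  refine hodgeConjectureFor_prod_menuBlock hW4 hM6 hA (e c) (n c) (hn c) (hdeg c) (h2c c) (i c) (τ c) (hS c) (h23 c) (h24 c) (hiso c) (hout4 c) ρ fun l => ?_
  have h := hcov (ρ l)
  rw [hρc l] at h
  exact h

/-- **Dominated form.** [cite: Markman2025SurveySecant, Thm. 1.2] [cite: Markman2025SecantWeil, Thm 1.5.1] [cite: MumfordAV1970, §19] -/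
theorem hodgeConjectureFor_of_avDominatedBy_prod_of_menuBlocks (hW4 : Markman2025_weilClasses_algebraic_abelianFourfold)
    (hM6 : Markman2025_weilClasses_algebraic_hyperbolicSixfold) (hA : ∀ i, IsCMTypeRealisation (Φ i) (A i) (ι i) (θ i)) (b : I → C) (e : ∀ c, Fin (r c) → I)
    (n : ∀ c, Fin (r c) → ℕ) (hn : ∀ c m, n c m = 3 ∨ n c m = 4 ∨ n c m = 5) (hdeg : ∀ c m, Module.finrank ℚ (K (e c m)) = 2 * n c m)
    (h2c : ∀ c, Module.finrank ℚ (kc c) = 2) (i : ∀ c m, kc c →+* K (e c m)) (τ : ∀ c, kc c →+* ℂ)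
    (hS : ∀ c m, n c m = 3 ∨ n c m = 4 → (A (e c m)).IsSimple)
    (h23 : ∀ c m, n c m = 5 → (Finset.univ.filter fun s : K (e c m) →+* ℂ => s.comp (i c m) = τ c ∧ s ∈ (Φ (e c m)).1).card = 2 ∨
      (Finset.univ.filter fun s : K (e c m) →+* ℂ => s.comp (i c m) = τ c ∧ s ∈ (Φ (e c m)).1).card = 3)
    (h24 : ∀ c m, n c m = 4 → ∃ s₀ t₀ : K (e c m) →+* ℂ, s₀.comp (i c m) = τ c ∧ t₀.comp (i c m) = τ c ∧ s₀ ≠ t₀ ∧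
      Module.finrank ℚ ↥(adjoin ℚ (Set.range (τ c)) ⊔ adjoin ℚ (Set.range s₀ ∪ Set.range t₀)) = 24)
    (hiso : ∀ c m₀ m, m₀ ≠ m → n c m₀ = n c m → (n c m = 3 ∨ n c m = 5) → IsEmpty (K (e c m) →+* K (e c m₀)))
    (hout4 : ∀ c m₀ m, m₀ ≠ m → n c m₀ = 4 → (n c m = 4 ∨ n c m = 3) →
      ∃ s : K (e c m) →+* ℂ, s.comp (i c m) = τ c ∧ ∃ x, s x ∉ normalClosure ℚ (K (e c m₀)) ℂ)
    (hcov : ∀ x : I, (Module.finrank ℚ (K x) = 2 ∧ Nonempty (K x →+* kc (b x))) ∨ ∃ m, x = e (b x) m)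
    (hreal : ∀ (c : C) (z : ℂ), z ∈ (⨆ x : {x : I // b x = c}, normalClosure ℚ (K x.1) ℂ) → z ∈ (⨆ x : {x : I // b x ≠ c}, normalClosure ℚ (K x.1) ℂ) →
      starRingEnd ℂ z = z)
    {N : ℕ} (π : Fin N → I) {X : AbelianVariety ℂ} (hX : Domination.AVDominatedBy X (⨁ fun j => A (π j))) : HodgeConjectureFor X.dim X.X :=
  Domination.hodgeConjectureFor_of_avDominatedBy
    (hodgeConjectureFor_prod_of_menuBlocks hW4 hM6 hA b e n hn hdeg h2c i τ hS h23 h24 hiso hout4 hcov hreal π) hX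

end Several

end Summit.HodgeConjecture.CorCM.MultiFieldWeil

end
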